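import Literature.AlgebraicGeometry.Resolution.DivisorialPart
import Literature.AlgebraicGeometry.Resolution.StalkIdealLemmas
import Mathlib.AlgebraicGeometry.Morphisms.Flat
import Mathlib.RingTheory.Ideal.KrullsHeightTheorem
import HarnessLib

/-!
# Crux `NoZenoR` (stmt-ResolutionOfSingularities-19943), β layer, `stub_L1wCoreF` descent brick for BC-4b:
# THE PULLED-BACK IDEAL OF AN EXCEPTIONAL CURVE ALONG AN UNRAMIFIED FLAT BASE CHANGE IS THE REDUCED
# UNION OF THE CURVES ABOVE IT

Route `ResolutionOfSingularities/HomologicalConductor`, crux chain W4.4.  OURS (cell res-hironaka, seat res-L0-w44-stub-2,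
(L1)-PREP v4 §2, planner (ρ43e)/(ρ48): BC-4b over the Galois hop `S → Ŝ` of res-D-pv-039's D2″); AI-written, weaker
than expert review; nothing here is a statement of the manuscript under review (Hironaka 2017).  Def-free,
`--supports 19943 --as helper`.

Let `σ : X_B → X` be a FLAT morphism of integral locally Noetherian REGULAR schemes (`X_B` Noetherian), `η ∈ X` a
codimension-one point (`coheight η = 1`, the generic point of an integral curve / prime divisor `E`, prime divisor ideal
`𝓘_η = primeDivisorIdeal η`), and suppose `σ` is UNRAMIFIED at the points `ζ` over `η` in the precise sense
`𝔪_η · 𝒪_{X_B,ζ} = 𝔪_ζ` (hypothesis `hunr`, discharged by the consumer: e.g. `σ` a base change of a localisation of a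
finite étale algebra).  Then:

* `comap_mul`, `comap_pow`, `isLocallyPrincipal_comap` — the inverse-image ideal sheaf (Mathlib
  `IdealSheafData.comap`) is multiplicative and preserves local principality (any morphism);
* `ringKrullDim_stalk_eq_of_map_maximalIdeal_eq`, `coheight_eq_of_map_maximalIdeal_eq` — at an unramified point of a
  flat morphism the dimension of the local ring does not change (dimension formula, Mathlib
  `Ideal.height_eq_height_add_of_liesOver_of_hasGoingDown`); `ringKrullDim_stalk_le_of_flat'` — along a flat morphism it
  does not drop;
* `stalkIdeal_comap_primeDivisorIdeal_eq_maximalIdeal`, `idealOrder_comap_primeDivisorIdeal_eq_one` — `𝓘_η·𝒪_{X_B,ζ} =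
  𝔪_ζ`, i.e. `ord_ζ(σ*𝓘_η) = 1` (the pulled-back curve is REDUCED at `ζ`);
* `divisorialPoints_comap_primeDivisorIdeal` — the codimension-one points of `σ⁻¹(E)` are exactly the points over `η`;
* **`comap_primeDivisorIdeal_eq_prod`** — `σ*𝓘_η = ∏_{ζ ↦ η} 𝓘_ζ`, the product of the prime divisor ideals of the
  (finitely many) points over `η` (the tree's divisorial decomposition `DivisorialPart` of Cossart–Piltant 2008,
  Prop. 4.2: a locally principal ideal equals its divisorial part `∏ 𝓘_ζ^{ord_ζ}`).

This is the «`Ê = E ×_κ κ̂ = C₁ + ⋯ + C_r` reduced» input of the proof of record of BC-4 (PREP v4 §2).  References: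
V. Cossart, O. Piltant, J. Algebra 320 (2008), proof of Prop. 4.2 (divisorial part) [`CossartPiltant2008`];
H. Matsumura, *Commutative Ring Theory* (1986), Thm. 15.1 (dimension formula for flat local homomorphisms)
[`Matsumura1987`]; context J. Lipman, Publ. Math. IHÉS 36 (1969) §16 (16.1) p. 231 [`Lipman1969`].
-/

noncomputable section

-- single-problem summit: the doubled namespace component `ResolutionOfSingularities` is forced
set_option linter.dupNamespace false

namespace Summit.ResolutionOfSingularities.ResolutionOfSingularities.Theorems.NoZeno.ExcCount

open CategoryTheory AlgebraicGeometry TopologicalSpace Topology IsLocalRing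
open Literature.AlgebraicGeometry.Resolution Scheme.IdealSheafData

universe u

/-! ## §1 The inverse-image ideal sheaf is multiplicative and preserves local principality -/

section Comap

variable {X Y : Scheme.{u}} (f : X ⟶ Y)

/-- The affine opens of `X` mapped by `f` into an affine open of `Y` cover `X`. [folklore] -/
theorem iSup_affineOpens_subordinate_eq_top :
    ⨆ V : {V : X.affineOpens // ∃ U : Y.affineOpens, (V : X.Opens) ≤ f ⁻¹ᵁ (U : Y.Opens)},
      (V.1 : X.Opens) = ⊤ := by
  refine top_le_iff.mp fun x _ => ?_
  obtain ⟨U, hU, hfxU, -⟩ :=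
    exists_isAffineOpen_mem_and_subset (X := Y) (x := f.base x) (U := ⊤) (Opens.mem_top _)
  obtain ⟨V, hV, hxV, hVU⟩ :=
    exists_isAffineOpen_mem_and_subset (X := X) (x := x) (U := f ⁻¹ᵁ U) hfxU
  exact Opens.mem_iSup.mpr ⟨⟨⟨V, hV⟩, ⟨U, hU⟩, hVU⟩, hxV⟩

/-- **`σ*(K₁ K₂) = σ*K₁ · σ*K₂`**: the inverse-image ideal sheaf is multiplicative (on an affine open `V` mapped into
an affine open `U` both sides are the extension of `K₁(U) K₂(U)` along `Γ(Y, U) → Γ(X, V)`, tree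
`ideal_comap_of_le`). [folklore] -/
theorem comap_mul (K₁ K₂ : Y.IdealSheafData) : (K₁ * K₂).comap f = K₁.comap f * K₂.comap f := by
  refine ext_of_iSup_eq_top _ (iSup_affineOpens_subordinate_eq_top f) fun V => ?_
  obtain ⟨U, hVU⟩ := V.2
  rw [ideal_comap_of_le f _ U V.1 hVU, ideal_mul, Pi.mul_apply, ideal_mul, Pi.mul_apply,
    ideal_comap_of_le f _ U V.1 hVU, ideal_comap_of_le f _ U V.1 hVU, Ideal.map_mul]

/-- **`σ*(Kⁿ) = (σ*K)ⁿ`**. [folklore] -/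
theorem comap_pow (K : Y.IdealSheafData) (n : ℕ) : (K ^ n).comap f = K.comap f ^ n := by
  induction n with
  | zero => rw [pow_zero, pow_zero]; exact comap_top f
  | succ n ih => rw [pow_succ, pow_succ, comap_mul, ih]

/-- **The inverse image of a locally principal ideal sheaf is locally principal** (stalkwise `(σ*K)_x = K_{σ x}·𝒪_{X,x}`
is generated by the image of a generator; tree `stalkIdeal_comap_eq_map_stalkMap`,
`isLocallyPrincipalAt_of_isPrincipal_stalkIdeal`). [folklore] -/
theorem isLocallyPrincipal_comap [IsLocallyNoetherian X] {K : Y.IdealSheafData} (hK : IsLocallyPrincipal K) :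
    IsLocallyPrincipal (K.comap f) := fun x => by
  refine isLocallyPrincipalAt_of_isPrincipal_stalkIdeal ?_
  rw [stalkIdeal_comap_eq_map_stalkMap]
  obtain ⟨g, hg⟩ := (hK (f.base x)).isPrincipal_stalkIdeal
  refine ⟨(f.stalkMap x).hom g, ?_⟩
  change (stalkIdeal K (f.base x)).map _ = Ideal.span {(f.stalkMap x).hom g}
  rw [show stalkIdeal K (f.base x) = Ideal.span {g} from hg, Ideal.map_span, Set.image_singleton]

end Comap

/-! ## §2 Dimension of local rings along a flat morphism -/

section FlatDim

variable {X XB : Scheme.{u}} (σ : XB ⟶ X) [Flat σ] [IsLocallyNoetherian X] [IsLocallyNoetherian XB]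

/-- **At an unramified point of a flat morphism the local ring keeps its dimension**: if `𝔪_{σ ζ}·𝒪_{X_B,ζ} = 𝔪_ζ` then
`dim 𝒪_{X_B,ζ} = dim 𝒪_{X,σ ζ}` (dimension formula for the flat local homomorphism `𝒪_{X,σ ζ} → 𝒪_{X_B,ζ}`, whose
closed fibre is a field). [cite: Matsumura1987, Thm. 15.1] -/
theorem ringKrullDim_stalk_eq_of_map_maximalIdeal_eq (ζ : XB)
    (hunr : (maximalIdeal (X.presheaf.stalk (σ.base ζ))).map (σ.stalkMap ζ).hom =
      maximalIdeal (XB.presheaf.stalk ζ)) :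
    ringKrullDim (XB.presheaf.stalk ζ) = ringKrullDim (X.presheaf.stalk (σ.base ζ)) := by
  let A := X.presheaf.stalk (σ.base ζ)
  let B := XB.presheaf.stalk ζ
  letI : Algebra A B := (σ.stalkMap ζ).hom.toAlgebra
  haveI : Module.Flat A B := Flat.stalkMap σ ζ
  haveI : IsLocalHom (algebraMap A B) := inferInstanceAs (IsLocalHom (σ.stalkMap ζ).hom)
  haveI : (maximalIdeal B).LiesOver (maximalIdeal A) :=
    ⟨(IsLocalRing.maximalIdeal_comap (algebraMap A B)).symm⟩
  have h' := Ideal.height_eq_height_add_of_liesOver_of_hasGoingDown (maximalIdeal A) (maximalIdeal B)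
  have hm : (maximalIdeal A).map (algebraMap A B) = maximalIdeal B := hunr
  rw [hm, Ideal.map_quotient_self, Ideal.height_bot, add_zero] at h'
  change ringKrullDim B = ringKrullDim A
  rw [← IsLocalRing.maximalIdeal_height_eq_ringKrullDim,
    ← IsLocalRing.maximalIdeal_height_eq_ringKrullDim, h']

/-- Codimension form: at an unramified point of a flat morphism, `coheight ζ = coheight (σ ζ)`. [cite: Matsumura1987, Thm. 15.1] -/
theorem coheight_eq_of_map_maximalIdeal_eq (ζ : XB)
    (hunr : (maximalIdeal (X.presheaf.stalk (σ.base ζ))).map (σ.stalkMap ζ).hom =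
      maximalIdeal (XB.presheaf.stalk ζ)) :
    Order.coheight ζ = Order.coheight (σ.base ζ) := by
  have h := ringKrullDim_stalk_eq_of_map_maximalIdeal_eq σ ζ hunr
  rw [ringKrullDim_stalk_eq_coheight, ringKrullDim_stalk_eq_coheight] at h
  exact_mod_cast h

/-- **Along a flat morphism the dimension of the local ring does not drop**: `dim 𝒪_{X,σ ζ} ≤ dim 𝒪_{X_B,ζ}` (going
down). [cite: Matsumura1987, Thm. 15.1] -/
theorem ringKrullDim_stalk_le_of_flat' (ζ : XB) :
    ringKrullDim (X.presheaf.stalk (σ.base ζ)) ≤ ringKrullDim (XB.presheaf.stalk ζ) := by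
  let A := X.presheaf.stalk (σ.base ζ)
  let B := XB.presheaf.stalk ζ
  letI : Algebra A B := (σ.stalkMap ζ).hom.toAlgebra
  haveI : Module.Flat A B := Flat.stalkMap σ ζ
  haveI : IsLocalHom (algebraMap A B) := inferInstanceAs (IsLocalHom (σ.stalkMap ζ).hom)
  haveI : (maximalIdeal B).LiesOver (maximalIdeal A) :=
    ⟨(IsLocalRing.maximalIdeal_comap (algebraMap A B)).symm⟩
  have h' := Ideal.height_eq_height_add_of_liesOver_of_hasGoingDown (maximalIdeal A) (maximalIdeal B)
  change ringKrullDim A ≤ ringKrullDim B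
  rw [← IsLocalRing.maximalIdeal_height_eq_ringKrullDim,
    ← IsLocalRing.maximalIdeal_height_eq_ringKrullDim, h']
  exact_mod_cast le_self_add

/-- Codimension form: `coheight (σ ζ) ≤ coheight ζ` along a flat morphism. [cite: Matsumura1987, Thm. 15.1] -/
theorem coheight_base_le_of_flat (ζ : XB) : Order.coheight (σ.base ζ) ≤ Order.coheight ζ := by
  have h := ringKrullDim_stalk_le_of_flat' σ ζ
  rw [ringKrullDim_stalk_eq_coheight, ringKrullDim_stalk_eq_coheight] at h
  exact_mod_cast h

end FlatDim

/-! ## §3 The pulled-back prime divisor ideal along an unramified flat morphism -/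

section PrimeDivisor

variable {X XB : Scheme.{u}} (σ : XB ⟶ X) [Flat σ]
  [IsIntegral X] [IsLocallyNoetherian X] [IsIntegral XB] [AlgebraicGeometry.IsNoetherian XB]
  {η : X} (hη : Order.coheight η = 1)

omit [Flat σ] [IsIntegral X] [IsLocallyNoetherian X] [IsIntegral XB] [AlgebraicGeometry.IsNoetherian XB] in
/-- **`𝓘_η · 𝒪_{X_B,ζ} = 𝔪_ζ` at an unramified point `ζ` over `η`** (`(σ*𝓘_η)_ζ` is the extension of `(𝓘_η)_η = 𝔪_η`).
[folklore] -/
theorem stalkIdeal_comap_primeDivisorIdeal_eq_maximalIdeal {ζ : XB} (hζ : σ.base ζ = η)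
    (hunr : (maximalIdeal (X.presheaf.stalk (σ.base ζ))).map (σ.stalkMap ζ).hom =
      maximalIdeal (XB.presheaf.stalk ζ)) :
    stalkIdeal ((primeDivisorIdeal η).comap σ) ζ = maximalIdeal (XB.presheaf.stalk ζ) := by
  subst hζ
  rw [stalkIdeal_comap_eq_map_stalkMap, stalkIdeal_primeDivisorIdeal_self, hunr]

omit [IsIntegral X] [IsIntegral XB] in
include hη in
/-- An unramified point `ζ` over the codimension-one point `η` has codimension one. [cite: Matsumura1987, Thm. 15.1] -/
theorem coheight_eq_one_of_map_maximalIdeal_eq {ζ : XB} (hζ : σ.base ζ = η)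
    (hunr : (maximalIdeal (X.presheaf.stalk (σ.base ζ))).map (σ.stalkMap ζ).hom =
      maximalIdeal (XB.presheaf.stalk ζ)) :
    Order.coheight ζ = 1 := by
  rw [coheight_eq_of_map_maximalIdeal_eq σ ζ hunr, hζ, hη]

omit [IsIntegral X] in
include hη in
/-- **`ord_ζ(σ*𝓘_η) = 1`**: the pulled-back curve is reduced at an unramified point `ζ` over `η` (`X_B` regular, so
`𝒪_{X_B,ζ}` is a discrete valuation ring and `(σ*𝓘_η)_ζ = 𝔪_ζ = 𝔪_ζ¹`). [folklore] -/
theorem idealOrder_comap_primeDivisorIdeal_eq_one (hXB : Scheme.IsRegular XB)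
    (hne : (primeDivisorIdeal η).comap σ ≠ ⊥) {ζ : XB} (hζ : σ.base ζ = η)
    (hunr : (maximalIdeal (X.presheaf.stalk (σ.base ζ))).map (σ.stalkMap ζ).hom =
      maximalIdeal (XB.presheaf.stalk ζ)) :
    idealOrder ((primeDivisorIdeal η).comap σ) ζ = 1 := by
  have hco := coheight_eq_one_of_map_maximalIdeal_eq σ hη hζ hunr
  obtain ⟨a, ha, he⟩ := exists_stalkIdeal_eq_maximalIdeal_pow hXB hco hne
  rw [stalkIdeal_comap_primeDivisorIdeal_eq_maximalIdeal σ hζ hunr] at he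
  rw [ha]
  -- `𝔪 = 𝔪^a` forces `a = 1`
  haveI := hXB ζ
  have hnf := not_isField_stalk_of_coheight_eq_one (X := XB) hco
  rcases Nat.lt_trichotomy a 1 with h0 | h1 | h2
  · exfalso
    have : a = 0 := by omega
    rw [this, pow_zero, Ideal.one_eq_top] at he
    exact (maximalIdeal.isMaximal (XB.presheaf.stalk ζ)).ne_top he
  · exact_mod_cast h1
  · exfalso
    have hle : maximalIdeal (XB.presheaf.stalk ζ) ^ 1 ≤ maximalIdeal (XB.presheaf.stalk ζ) ^ 2 := by
      calc maximalIdeal (XB.presheaf.stalk ζ) ^ 1 = maximalIdeal (XB.presheaf.stalk ζ) ^ a := by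
            rw [pow_one]; exact he
        _ ≤ maximalIdeal (XB.presheaf.stalk ζ) ^ 2 := Ideal.pow_le_pow_right h2
    exact maximalIdeal_pow_succ_ne hnf 1 (le_antisymm (Ideal.pow_le_pow_right (Nat.le_succ 1)) hle)

omit [IsIntegral X] [IsIntegral XB] in
include hη in
/-- **The codimension-one points of `σ⁻¹(E)` lie over `η`**: a codimension-one point `ζ` of `supp(σ*𝓘_η) = σ⁻¹(cl{η})`
maps to `η` — otherwise `σ ζ` is a proper specialisation of `η`, of codimension `≥ 2`, and `coheight (σ ζ) ≤ coheight ζ`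
along the flat `σ`. [cite: Matsumura1987, Thm. 15.1] -/
theorem base_eq_of_mem_divisorialPoints_comap {ζ : XB}
    (hζ : ζ ∈ divisorialPoints ((primeDivisorIdeal η).comap σ)) : σ.base ζ = η := by
  obtain ⟨hsupp, hco⟩ := hζ
  have hsp : η ⤳ σ.base ζ := by
    have h : ζ ∈ ((primeDivisorIdeal η).comap σ).support := hsupp
    rw [support_comap] at h
    exact (mem_support_primeDivisorIdeal_iff η (σ.base ζ)).mp h
  by_contra hne
  -- `σ ζ < η` strictly, so `coheight (σ ζ) ≥ 2`
  have hlt : σ.base ζ < η :=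
    ⟨Scheme.le_iff_specializes.2 hsp, fun h' => hne ((hsp.antisymm (Scheme.le_iff_specializes.1 h')).eq).symm⟩
  have h2 : Order.coheight η + 1 ≤ Order.coheight (σ.base ζ) := Order.coheight_add_one_le hlt
  have h3 := coheight_base_le_of_flat σ ζ
  rw [hη] at h2
  rw [hco] at h3
  have h4 : (1 : ℕ∞) + 1 ≤ 1 := h2.trans h3
  exact absurd h4 (by decide)

omit [IsIntegral X] [IsIntegral XB] in
include hη in
/-- **The codimension-one points of `σ⁻¹(E)` are exactly the points over `η`**, when `σ` is unramified at the points over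
`η`. [cite: Matsumura1987, Thm. 15.1] -/
theorem divisorialPoints_comap_primeDivisorIdeal
    (hunr : ∀ ζ : XB, σ.base ζ = η →
      (maximalIdeal (X.presheaf.stalk (σ.base ζ))).map (σ.stalkMap ζ).hom = maximalIdeal (XB.presheaf.stalk ζ)) :
    divisorialPoints ((primeDivisorIdeal η).comap σ) = σ.base ⁻¹' {η} := by
  ext ζ
  constructor
  · exact fun h => base_eq_of_mem_divisorialPoints_comap σ hη h
  · intro (hζ : σ.base ζ = η)
    refine ⟨?_, coheight_eq_one_of_map_maximalIdeal_eq σ hη hζ (hunr ζ hζ)⟩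
    show ζ ∈ ((primeDivisorIdeal η).comap σ).support
    rw [support_comap]
    show σ.base ζ ∈ (primeDivisorIdeal η).support
    rw [mem_support_primeDivisorIdeal_iff, hζ]

omit [Flat σ] [IsIntegral X] [IsLocallyNoetherian X] [IsIntegral XB] [AlgebraicGeometry.IsNoetherian XB] in
/-- `σ*𝓘_η ≠ 0` as soon as some point lies over `η` unramifiedly (its stalk there is `𝔪_ζ ≠ 0`). [folklore] -/
theorem comap_primeDivisorIdeal_ne_bot {ζ : XB} (hζ : σ.base ζ = η) (hco : Order.coheight ζ = 1)
    (hunr : (maximalIdeal (X.presheaf.stalk (σ.base ζ))).map (σ.stalkMap ζ).hom =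
      maximalIdeal (XB.presheaf.stalk ζ)) :
    (primeDivisorIdeal η).comap σ ≠ ⊥ := by
  intro h
  have hst := stalkIdeal_comap_primeDivisorIdeal_eq_maximalIdeal σ hζ hunr
  rw [h] at hst
  have hbot : stalkIdeal (⊥ : XB.IdealSheafData) ζ = ⊥ := by
    rw [← comap_bot σ, stalkIdeal_comap_eq_map_stalkMap]
    rw [show stalkIdeal (⊥ : X.IdealSheafData) (σ.base ζ) = ⊥ from ?_, Ideal.map_bot]
    rw [eq_bot_iff]
    intro s hs
    rw [stalkIdeal] at hs
    simpa using hs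
  rw [hbot] at hst
  exact not_isField_stalk_of_coheight_eq_one (X := XB) hco
    (isField_iff_maximalIdeal_eq.mpr hst.symm)

include hη in
/-- **`σ*𝓘_η = ∏_{ζ ↦ η} 𝓘_ζ`**: along a flat morphism of integral regular schemes unramified over the codimension-one
point `η`, the inverse image of the prime divisor ideal `𝓘_η` is the product of the prime divisor ideals of the (finitely
many) points `ζ` over `η` — it is locally principal, hence equal to its divisorial part `∏ 𝓘_ζ^{ord_ζ}` (tree
`DivisorialPart`: `divisorialPart_mul_codimTwoPart`, `isLocallyPrincipal_iff_codimTwoPart_eq_top`), and all the orders are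
`1`. [cite: CossartPiltant2008, proof of Prop. 4.2] -/
theorem comap_primeDivisorIdeal_eq_prod (hX : Scheme.IsRegular X) (hXB : Scheme.IsRegular XB)
    (hunr : ∀ ζ : XB, σ.base ζ = η →
      (maximalIdeal (X.presheaf.stalk (σ.base ζ))).map (σ.stalkMap ζ).hom = maximalIdeal (XB.presheaf.stalk ζ))
    (hne : (primeDivisorIdeal η).comap σ ≠ ⊥) (hfin : (σ.base ⁻¹' {η}).Finite) :
    (primeDivisorIdeal η).comap σ = ∏ ζ ∈ hfin.toFinset, primeDivisorIdeal ζ := by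
  classical
  set I := (primeDivisorIdeal η).comap σ with hI
  -- `I` is locally principal, so its part of codimension `≥ 2` is trivial
  have hlp : IsLocallyPrincipal I :=
    isLocallyPrincipal_comap σ (isEffectiveCartier_primeDivisorIdeal_of_isRegular hX hη).isLocallyPrincipal
  have hJ : codimTwoPart I = ⊤ := (isLocallyPrincipal_iff_codimTwoPart_eq_top hXB hne).mp hlp
  have hdec := divisorialPart_mul_codimTwoPart hXB hne
  rw [hJ, Scheme.IdealSheafData.mul_top] at hdec
  -- and its divisorial part is `∏ 𝓘_ζ^{ord_ζ I}` over the codimension-one points, all of order `1`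
  have hpts : divisorialPoints I = σ.base ⁻¹' {η} := divisorialPoints_comap_primeDivisorIdeal σ hη hunr
  have hfin' : (divisorialPoints I).Finite := by rw [hpts]; exact hfin
  rw [← hdec, divisorialPart_eq hfin']
  have hset : hfin'.toFinset = hfin.toFinset := by
    ext ζ
    rw [Set.Finite.mem_toFinset, Set.Finite.mem_toFinset, hpts]
  rw [hset]
  refine Finset.prod_congr rfl fun ζ hζ => ?_
  have hζ' : σ.base ζ = η := by simpa using (Set.Finite.mem_toFinset _).mp hζ
  rw [idealOrder_comap_primeDivisorIdeal_eq_one σ hη hXB hne hζ' (hunr ζ hζ'), ENat.toNat_one, pow_one]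

end PrimeDivisor

end Summit.ResolutionOfSingularities.ResolutionOfSingularities.Theorems.NoZeno.ExcCount

end
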